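import Literature.NumberTheory.Automorphic.SmoothRepresentation
import Literature.RepresentationTheory.FixedPointsTraceAverage
import Mathlib.Analysis.InnerProductSpace.Projection.Basic
import Mathlib.Analysis.RCLike.Lemmas
import Mathlib.LinearAlgebra.Eigenspace.Triangularizable
import Mathlib.Analysis.Complex.Polynomial.Basic
import Mathlib.Topology.Algebra.OpenSubgroup
import HarnessLib

/-!
# FLOOR-0 P2a (B4-archimedean desk), line 2 `F0_P2aCohIsotypicLine` — STUB S1 CLOSED: Schur's lemma for `G`-invariant
# sesquilinear forms on an irreducible admissible representation

Cell hodgecm-mathlib (D-0151), FLOOR 0, crux item H413 = stmt-HodgeConjecture-24833; sub-line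
`Cruxes/H413/Lines/F0_P2aCohIsotypicLine.lean` (F0P2a-plan (g2), edition 1, sha16 fe64be0a9875628f), registered stub
`stub_sesqSchur : SesqSchurType` (§1/§2 there).  PROOF lane (theorems only); author F0P2a-p04 (g0).  Per the cell's stub-closer
protocol the Lines module is NOT imported: the type of `stubS1_holds` is the body of
`…Cruxes.H413.F0P2aCohIsotypicLine.SesqSchurType` BINDER FOR BINDER, and the by-name fold
`theorem stub_sesqSchur : SesqSchurType := F0P2aStubS1SesqSchur.stubS1_holds` goes into the line at its next edition.

## Content
`G` a topological group with a compact open subgroup, `σ` an irreducible ADMISSIBLE representation of `G` on a complex vector space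
`W` (no topology; ★ `Representation.IsAdmissible` of `SmoothRepresentation`), `φ₁ φ₂ : W →ₗ[ℂ] V` linear maps to a complex
inner-product space such that the sesquilinear forms `b₁ = ⟪φ₁ ·, φ₁ ·⟫` and `b₂ = ⟪φ₁ ·, φ₂ ·⟫` are `σ(G)`-invariant.  Then
`b₂ = c · b₁` for a constant `c` (`exists_inner_eq_mul_inner`, `stubS1_holds`).

## Proof
1. `ker φ₁` is a subrepresentation (`b₁(σ g w, σ g w) = b₁(w, w)`), so `φ₁` is injective or zero (`injective_or_eq_zero_of_inner_invariant`);
   if zero, `c = 0`.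
2. Let `w₀ ≠ 0` (irreducible ⇒ `W ≠ 0`), `K := K₀ ⊓ Stab(w₀)` (compact open, smoothness) and `U := W^K` (finite-dimensional by
   admissibility, `∋ w₀`).  On the finite-dimensional subspace `E := φ₁(U) ⊆ V` the orthogonal projection exists (Mathlib
   `Submodule.orthogonalProjectionOnto`), and `A := (φ₁|_U)⁻¹ ∘ pr_E ∘ φ₂|_U : U → U` satisfies `b₁(u, A u') = b₂(u, u')` (Riesz).
   `A` has an eigenvector `v ≠ 0`, `A v = c v` (Mathlib `Module.End.exists_eigenvalue`), so `b₂(u, v) = c b₁(u, v)` for `u ∈ U`.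
3. Finite averaging (★ `FixedPointsTraceAverage.exists_average_family`; `Stab(w) ∩ K` has finite index in the compact `K`,
   `finiteIndex_stabilizerSubgroup_subgroupOf`) sends any `w` to `P w ∈ U` with `⟪φ₁ (P w), y⟫ = ⟪φ₁ w, y⟫` for the `K`-invariant
   vector `y := φ₂ v - c φ₁ v`; hence `b₂(w, v) = c b₁(w, v)` for ALL `w`.
4. `{w' ∣ ∀ w, b₂(w, w') = c b₁(w, w')}` is a subrepresentation containing `v ≠ 0`, hence everything
   (`forall_inner_eq_mul_inner`).

HC_CM is proved only modulo the 7 printed citations until rung 0 closes; this file closes ONE generic stub (S1) of ONE floor-0 sub-line and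
uses no printed citation.

## References
* [BernsteinZelevinsky1976] I. N. Bernstein, A. V. Zelevinsky, Russian Math. Surveys 31 (1976), §2 (2.1 (b) admissible; 2.11 Schur).
* [Bump1997] D. Bump, *Automorphic Forms and Representations*, CUP 1997, §4.2, Proposition 4.2.4 and Eq. (2.8) (the projector `π(ε_K)`).
* Tree: ★ `Literature/NumberTheory/Automorphic/SmoothRepresentation` (`IsSmooth`, `IsAdmissible`, `fixedPoints`, `stabilizerSubgroup`),
  ★ `Literature/RepresentationTheory/FixedPointsTraceAverage` (`exists_average_family`); Mathlib `Representation.IsIrreducible`,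
  `Subrepresentation`, `Module.End.exists_eigenvalue`, `Submodule.orthogonalProjectionOnto`, `Submodule.equivMapOfInjective`.
-/

set_option autoImplicit false
set_option linter.dupNamespace false

noncomputable section

open scoped InnerProductSpace

namespace Summit.HodgeConjecture.HodgeConjecture.Cruxes.H413.F0P2aStubS1SesqSchur

open Literature.RepresentationTheory

/-! ## §1 Algebra: the kernel dichotomy and the eigen-line subrepresentation -/

section Algebra

variable {G : Type*} [Group G] {W : Type*} [AddCommGroup W] [Module ℂ W] (σ : Representation ℂ G W)
  {V : Type*} [NormedAddCommGroup V] [InnerProductSpace ℂ V]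

/-- **Step 1.** If `⟪φ₁ (σ g w), φ₁ (σ g w)⟫ = ⟪φ₁ w, φ₁ w⟫` for all `g, w` and `σ` is irreducible, then `ker φ₁` is a
subrepresentation, hence `φ₁` is injective or zero. [cite: BernsteinZelevinsky1976, §2] -/
theorem injective_or_eq_zero_of_inner_invariant [σ.IsIrreducible] (φ₁ : W →ₗ[ℂ] V)
    (hb₁ : ∀ (g : G) (w : W), ⟪φ₁ (σ g w), φ₁ (σ g w)⟫_ℂ = ⟪φ₁ w, φ₁ w⟫_ℂ) :
    Function.Injective φ₁ ∨ φ₁ = 0 := by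
  let N : Subrepresentation σ :=
    { toSubmodule := LinearMap.ker φ₁
      apply_mem_toSubmodule := fun g w hw => by
        rw [LinearMap.mem_ker] at hw ⊢
        have h := hb₁ g w
        rw [hw, inner_zero_left] at h
        exact inner_self_eq_zero.mp h }
  rcases IsSimpleOrder.eq_bot_or_eq_top N with hN | hN
  · left
    rw [← LinearMap.ker_eq_bot]
    exact congrArg Subrepresentation.toSubmodule hN
  · right
    rw [← LinearMap.ker_eq_top]
    exact congrArg Subrepresentation.toSubmodule hN

/-- **Step 4.** For `σ` irreducible and `σ(G)`-invariant forms `⟪φ₁ ·, φ₁ ·⟫`, `⟪φ₁ ·, φ₂ ·⟫`, the set of `w'` with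
`⟪φ₁ w, φ₂ w'⟫ = c * ⟪φ₁ w, φ₁ w'⟫` for every `w` is a subrepresentation; if it contains a non-zero vector it is everything.
[cite: BernsteinZelevinsky1976, §2] [cite: Bump1997, Proposition 4.2.4] -/
theorem forall_inner_eq_mul_inner [σ.IsIrreducible] (φ₁ φ₂ : W →ₗ[ℂ] V) (c : ℂ)
    (hb₁ : ∀ (g : G) (w w' : W), ⟪φ₁ (σ g w), φ₁ (σ g w')⟫_ℂ = ⟪φ₁ w, φ₁ w'⟫_ℂ)
    (hb₂ : ∀ (g : G) (w w' : W), ⟪φ₁ (σ g w), φ₂ (σ g w')⟫_ℂ = ⟪φ₁ w, φ₂ w'⟫_ℂ)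
    {v : W} (hv : v ≠ 0) (hvc : ∀ w : W, ⟪φ₁ w, φ₂ v⟫_ℂ = c * ⟪φ₁ w, φ₁ v⟫_ℂ) :
    ∀ w w' : W, ⟪φ₁ w, φ₂ w'⟫_ℂ = c * ⟪φ₁ w, φ₁ w'⟫_ℂ := by
  have hinv : ∀ (g : G) (w : W), σ g (σ g⁻¹ w) = w := fun g w => by
    rw [← Module.End.mul_apply, ← map_mul, mul_inv_cancel, map_one, Module.End.one_apply]
  let S : Subrepresentation σ :=
    { toSubmodule :=
        { carrier := {w' : W | ∀ w : W, ⟪φ₁ w, φ₂ w'⟫_ℂ = c * ⟪φ₁ w, φ₁ w'⟫_ℂ}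
          zero_mem' := fun w => by simp only [map_zero, inner_zero_right, mul_zero]
          add_mem' := fun {x y} hx hy w => by
            simp only [Set.mem_setOf_eq] at hx hy
            simp only [map_add, inner_add_right, hx w, hy w, mul_add]
          smul_mem' := fun a x hx w => by
            simp only [Set.mem_setOf_eq] at hx
            simp only [map_smul, inner_smul_right, hx w]
            ring }
      apply_mem_toSubmodule := fun g w' hw' w => by
        change ∀ w : W, ⟪φ₁ w, φ₂ w'⟫_ℂ = c * ⟪φ₁ w, φ₁ w'⟫_ℂ at hw'
        calc ⟪φ₁ w, φ₂ (σ g w')⟫_ℂ = ⟪φ₁ (σ g (σ g⁻¹ w)), φ₂ (σ g w')⟫_ℂ := by rw [hinv]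
          _ = ⟪φ₁ (σ g⁻¹ w), φ₂ w'⟫_ℂ := hb₂ g _ _
          _ = c * ⟪φ₁ (σ g⁻¹ w), φ₁ w'⟫_ℂ := hw' _
          _ = c * ⟪φ₁ (σ g (σ g⁻¹ w)), φ₁ (σ g w')⟫_ℂ := by rw [hb₁ g]
          _ = c * ⟪φ₁ w, φ₁ (σ g w')⟫_ℂ := by rw [hinv] }
  have hvS : v ∈ S := hvc
  rcases IsSimpleOrder.eq_bot_or_eq_top S with hS | hS
  · exfalso
    apply hv
    have h : v ∈ (⊥ : Subrepresentation σ) := hS ▸ hvS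
    exact (Submodule.mem_bot ℂ).mp h
  · intro w w'
    have h : w' ∈ S := hS ▸ (show w' ∈ (⊤ : Subrepresentation σ) from Submodule.mem_top)
    exact h w

end Algebra

/-! ## §2 Topology: finite index of stabilisers in a compact subgroup, and the finite average into `W^K` -/

section Topological

variable {G : Type*} [Group G] [TopologicalSpace G] [IsTopologicalGroup G]
  {W : Type*} [AddCommGroup W] [Module ℂ W] (σ : Representation ℂ G W)

/-- For a smooth `σ`, the stabiliser of any vector meets a compact subgroup `K` in a subgroup of finite index of `K` (an open
subgroup of a compact group has finite quotient). [cite: Bump1997, §4.2 (smooth representations, V = ⋃ V^K₀)] -/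
theorem finiteIndex_stabilizerSubgroup_subgroupOf (hsm : σ.IsSmooth) {K : Subgroup G} (hK : IsCompact (K : Set G))
    (w : W) : ((σ.stabilizerSubgroup w).subgroupOf K).FiniteIndex := by
  haveI : CompactSpace K := isCompact_iff_compactSpace.mp hK
  haveI : Finite (K ⧸ (σ.stabilizerSubgroup w).subgroupOf K) :=
    Subgroup.quotient_finite_of_isOpen _ (Subgroup.subgroupOf_isOpen K _ (hsm w))
  exact Subgroup.finiteIndex_of_finite_quotient

/-- **Step 3 (averaging).** For a smooth `σ`, a compact subgroup `K` and any `w`, the finite average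
`[K : K ∩ Stab w]⁻¹ • ∑ᵢ σ(tᵢ) w` over a left transversal `tᵢ ∈ K` (★ `exists_average_family`) is a `K`-fixed vector.
[cite: Bump1997, §4.2 Eq. (2.8)] -/
theorem exists_smul_sum_mem_fixedPoints (hsm : σ.IsSmooth) {K : Subgroup G} (hK : IsCompact (K : Set G)) (w : W) :
    ∃ (n : ℕ) (t : Fin n → G), n ≠ 0 ∧ (∀ i, t i ∈ K) ∧
      ((n : ℂ)⁻¹ • ∑ i, σ (t i) w) ∈ σ.fixedPoints K := by
  haveI := finiteIndex_stabilizerSubgroup_subgroupOf σ hsm hK w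
  obtain ⟨n, t, hn, ht, -, hPinv⟩ := exists_average_family σ K (σ.stabilizerSubgroup w)
  refine ⟨n, t, hn, ht, ?_⟩
  rw [Representation.mem_fixedPoints]
  intro g hg
  have h := hPinv w (fun g' hg' => (σ.mem_stabilizerSubgroup w g').mp hg') g hg
  simpa only [LinearMap.smul_apply, LinearMap.coe_sum, Finset.sum_apply] using h

variable {V : Type*} [NormedAddCommGroup V] [InnerProductSpace ℂ V]

/-- **Schur's lemma for invariant sesquilinear forms** (generic form of stub S1): `σ` irreducible admissible, `G` with a compact
open subgroup, `b₁ = ⟪φ₁ ·, φ₁ ·⟫` and `b₂ = ⟪φ₁ ·, φ₂ ·⟫` invariant ⇒ `b₂ = c · b₁`.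
[cite: BernsteinZelevinsky1976, §2] [cite: Bump1997, Proposition 4.2.4] -/
theorem exists_inner_eq_mul_inner (hirr : σ.IsIrreducible) (hadm : σ.IsAdmissible)
    (hK : ∃ K : OpenSubgroup G, IsCompact (K : Set G)) (φ₁ φ₂ : W →ₗ[ℂ] V)
    (hb₁ : ∀ (g : G) (w w' : W), ⟪φ₁ (σ g w), φ₁ (σ g w')⟫_ℂ = ⟪φ₁ w, φ₁ w'⟫_ℂ)
    (hb₂ : ∀ (g : G) (w w' : W), ⟪φ₁ (σ g w), φ₂ (σ g w')⟫_ℂ = ⟪φ₁ w, φ₂ w'⟫_ℂ) :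
    ∃ c : ℂ, ∀ w w' : W, ⟪φ₁ w, φ₂ w'⟫_ℂ = c * ⟪φ₁ w, φ₁ w'⟫_ℂ := by
  classical
  haveI := hirr
  obtain ⟨K₀, hK₀⟩ := hK
  have hsm : σ.IsSmooth := hadm.isSmooth
  rcases injective_or_eq_zero_of_inner_invariant σ φ₁ (fun g w => hb₁ g w w) with hinj | h0
  swap
  · exact ⟨0, fun w w' => by simp [h0]⟩
  -- a non-zero vector (irreducible representations are non-zero)
  obtain ⟨w₀, hw₀⟩ : ∃ w₀ : W, w₀ ≠ 0 := by
    by_contra h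
    push Not at h
    have hbt : (⊥ : Subrepresentation σ) = ⊤ :=
      Subrepresentation.toSubmodule_injective (Submodule.ext fun w => by
        change w ∈ (⊥ : Submodule ℂ W) ↔ w ∈ (⊤ : Submodule ℂ W)
        simp only [Submodule.mem_bot, h w, Submodule.mem_top])
    exact bot_ne_top hbt
  -- Step 2: the compact open subgroup `K = K₀ ∩ Stab(w₀)` and the finite-dimensional `U = W^K ∋ w₀`
  let K : OpenSubgroup G := K₀ ⊓ ⟨σ.stabilizerSubgroup w₀, hsm w₀⟩
  have hKc : IsCompact ((K : Subgroup G) : Set G) := by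
    rw [OpenSubgroup.coe_toSubgroup, OpenSubgroup.coe_inf]
    exact hK₀.inter_right (OpenSubgroup.isClosed _)
  let U : Submodule ℂ W := σ.fixedPoints (K : Subgroup G)
  haveI : Module.Finite ℂ U := hadm.finite_fixedPoints K hKc
  have hw₀U : w₀ ∈ U := by
    rw [Representation.mem_fixedPoints]
    intro g hg
    exact (σ.mem_stabilizerSubgroup w₀ g).mp (OpenSubgroup.mem_inf.mp hg).2
  haveI : Nontrivial U := ⟨⟨⟨w₀, hw₀U⟩, 0, fun h => hw₀ (congrArg Subtype.val h)⟩⟩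
  -- the Riesz operator `A` on `U` through the orthogonal projection onto `E = φ₁(U)`
  let E : Submodule ℂ V := U.map φ₁
  let e : U ≃ₗ[ℂ] E := Submodule.equivMapOfInjective φ₁ hinj U
  let A : Module.End ℂ U :=
    e.symm.toLinearMap ∘ₗ ((E.orthogonalProjectionOnto : V →ₗ[ℂ] E) ∘ₗ (φ₂ ∘ₗ U.subtype))
  have hA : ∀ u u' : U, ⟪φ₁ u, φ₁ (A u')⟫_ℂ = ⟪φ₁ u, φ₂ u'⟫_ℂ := by
    intro u u'
    have h1 : φ₁ (A u' : W) = (E.orthogonalProjectionOnto (φ₂ u') : V) := by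
      rw [← Submodule.coe_equivMapOfInjective_apply φ₁ hinj U (A u')]
      change ((e (e.symm (E.orthogonalProjectionOnto (φ₂ (u' : W))))) : V) = _
      rw [LinearEquiv.apply_symm_apply]
    rw [h1]
    have h2 := Submodule.inner_orthogonalProjectionOnto_eq_of_mem_left (K := E)
      ⟨φ₁ u, Submodule.mem_map_of_mem u.2⟩ (φ₂ u')
    rwa [Submodule.coe_inner] at h2
  -- an eigenvector `v` of `A`
  obtain ⟨c, hc⟩ := Module.End.exists_eigenvalue A
  obtain ⟨v, hv⟩ := hc.exists_hasEigenvector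
  have hvne : (v : W) ≠ 0 := fun h => hv.2 (Subtype.ext h)
  have hvU : ∀ u : U, ⟪φ₁ u, φ₂ v⟫_ℂ = c * ⟪φ₁ u, φ₁ v⟫_ℂ := by
    intro u
    rw [← hA u v, hv.apply_eq_smul, Submodule.coe_smul, map_smul, inner_smul_right]
  -- Step 3: extend to all `w` by averaging (`y = φ₂ v - c • φ₁ v` is `K`-invariant and `⊥ φ₁(U)`)
  have hyU : ∀ u ∈ U, ⟪φ₁ u, φ₂ v - c • φ₁ v⟫_ℂ = 0 := fun u hu => by
    rw [inner_sub_right, inner_smul_right, hvU ⟨u, hu⟩, sub_self]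
  have hyK : ∀ (w : W), ∀ g ∈ (K : Subgroup G),
      ⟪φ₁ (σ g w), φ₂ v - c • φ₁ v⟫_ℂ = ⟪φ₁ w, φ₂ v - c • φ₁ v⟫_ℂ := by
    intro w g hg
    have hgv : σ g (v : W) = v := (σ.mem_fixedPoints _ _).mp v.2 g hg
    have h2 : ⟪φ₁ (σ g w), φ₂ v⟫_ℂ = ⟪φ₁ w, φ₂ v⟫_ℂ := by
      calc ⟪φ₁ (σ g w), φ₂ v⟫_ℂ = ⟪φ₁ (σ g w), φ₂ (σ g v)⟫_ℂ := by rw [hgv]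
        _ = ⟪φ₁ w, φ₂ v⟫_ℂ := hb₂ g w v
    have h1 : ⟪φ₁ (σ g w), φ₁ v⟫_ℂ = ⟪φ₁ w, φ₁ v⟫_ℂ := by
      calc ⟪φ₁ (σ g w), φ₁ v⟫_ℂ = ⟪φ₁ (σ g w), φ₁ (σ g v)⟫_ℂ := by rw [hgv]
        _ = ⟪φ₁ w, φ₁ v⟫_ℂ := hb₁ g w v
    rw [inner_sub_right, inner_sub_right, inner_smul_right, inner_smul_right, h1, h2]
  have hy : ∀ w : W, ⟪φ₁ w, φ₂ v - c • φ₁ v⟫_ℂ = 0 := by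
    intro w
    obtain ⟨n, t, hn, ht, hmem⟩ := exists_smul_sum_mem_fixedPoints σ hsm hKc w
    have h0 := hyU _ hmem
    rw [map_smul, map_sum, inner_smul_left, sum_inner,
      Finset.sum_congr rfl (fun i _ => hyK w (t i) (ht i)), Finset.sum_const, Finset.card_univ,
      Fintype.card_fin, nsmul_eq_mul] at h0
    have hn' : (n : ℂ) ≠ 0 := Nat.cast_ne_zero.mpr hn
    rcases mul_eq_zero.mp h0 with h | h
    · rw [map_inv₀, map_natCast] at h
      exact absurd h (inv_ne_zero hn')
    · rcases mul_eq_zero.mp h with h | h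
      · exact absurd h hn'
      · exact h
  have hvall : ∀ w : W, ⟪φ₁ w, φ₂ v⟫_ℂ = c * ⟪φ₁ w, φ₁ v⟫_ℂ := fun w => by
    rw [← sub_eq_zero, ← inner_smul_right, ← inner_sub_right]
    exact hy w
  -- Step 4: irreducibility
  exact ⟨c, forall_inner_eq_mul_inner σ φ₁ φ₂ c hb₁ hb₂ hvne hvall⟩

end Topological

/-! ## §3 The registered stub S1, binder for binder -/

/-- **STUB S1 of line `F0_P2aCohIsotypicLine`, proved** — the body of `SesqSchurType` binder for binder: Schur's lemma for
`G`-invariant sesquilinear forms `⟪φ₁ ·, φ₁ ·⟫`, `⟪φ₁ ·, φ₂ ·⟫` on an irreducible admissible representation of a topological group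
with a compact open subgroup. [cite: BernsteinZelevinsky1976, §2] [cite: Bump1997, Proposition 4.2.4] -/
theorem stubS1_holds :
    ∀ (G : Type) [Group G] [TopologicalSpace G] [IsTopologicalGroup G] (W : Type) [AddCommGroup W] [Module ℂ W]
    (σ : Representation ℂ G W), σ.IsIrreducible → σ.IsAdmissible → (∃ K : OpenSubgroup G, IsCompact (K : Set G)) →
    ∀ (V : Type) [NormedAddCommGroup V] [InnerProductSpace ℂ V] (φ₁ φ₂ : W →ₗ[ℂ] V),
      (∀ (g : G) (w w' : W), ⟪φ₁ (σ g w), φ₁ (σ g w')⟫_ℂ = ⟪φ₁ w, φ₁ w'⟫_ℂ) →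
      (∀ (g : G) (w w' : W), ⟪φ₁ (σ g w), φ₂ (σ g w')⟫_ℂ = ⟪φ₁ w, φ₂ w'⟫_ℂ) →
      ∃ c : ℂ, ∀ w w' : W, ⟪φ₁ w, φ₂ w'⟫_ℂ = c * ⟪φ₁ w, φ₁ w'⟫_ℂ :=
  fun _ _ _ _ _ _ _ σ hirr hadm hK _ _ _ φ₁ φ₂ hb₁ hb₂ =>
    exists_inner_eq_mul_inner σ hirr hadm hK φ₁ φ₂ hb₁ hb₂

end Summit.HodgeConjecture.HodgeConjecture.Cruxes.H413.F0P2aStubS1SesqSchur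

end
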